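import Summits.NavierStokesRegularity.NavierStokesRegularity.Theorems.StretchingWellBindingEnstrophyQuarterLawTraceTransferFastL3
import Summits.NavierStokesRegularity.NavierStokesRegularity.Theorems.TypeIQuarterGateLorentzBoundOfEnvelope
import Summits.NavierStokesRegularity.NavierStokesRegularity.Theorems.TypeICertificateLadderRungReynoldsOneTaoCover
import Literature.Analysis.FluidPDE.NSCriticalClosureTao
import Literature.Analysis.FluidPDE.TaoLocalisation
import Summits.NavierStokesRegularity.NavierStokesRegularity.Theorems.SoloSalvageWu2026WeakLpAlgebra
import Literature.Analysis.FunctionSpaces.WeakLp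
import Literature.Analysis.FunctionSpaces.WeakLpFatou
import HarnessLib

/-!
# Shelf 1574, line «weak_trace» (weak-`L³` twin of LINE 9 «trace_transfer»): STUBS 2–5

Helper file (`--supports stmt-NavierStokesRegularity-1574 --as helper`) for the banked crux line
`Cruxes/EnstrophyQuarterLaw/Lines/weak_trace.lean` (seat ns-idea-9 g4, lens «wuc»): the weak-`L³`
TRACE TRANSFER under the edge law. The line's five registered stubs are

* STUB 1 `stub_edgeLaw` — LANDED (`Theorems.NoTerminalJolt.edgeLaw_lintegral`, `QuarterJoltEdgeLaw.lean`,
  literally the body of the line's `EdgeLaw`);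
* STUB 2 `stub_fastWeakL3` — THIS FILE: the slice law `∫|curl u(t)|² ≤ K/√(T−t)` pays every level above
  the self-similar threshold, `μ³|{μ < |u(s)|}| ≤ C` for `μ ≥ (√(T−s))⁻¹` (cubic Chebyshev on the landed
  cubic-mass bound `TraceTransfer.stub_fastL3`, `C = C_S⁶ (max K 0)³`);
* STUB 3 `stub_weakTransfer` — THIS FILE (the lever, pure measure theory): edge bound
  `∫|u(s) − u(T)|² ≤ D√(T−s)` + fast-level bound + `u(T) ∈ L^{3,∞}` ⟹ the weak-`L³` quasi-norms of the
  late slices are bounded: below the threshold `μ³|{μ<|u(s)|}| ≤ 8‖u(T)‖³_{3,∞} + 4μ D√(T−s) ≤ 8N + 4D`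
  (`{μ < |u(s)|} ⊆ {μ/2 < |u(T)|} ∪ {μ/2 < |u(s) − u(T)|}`, Chebyshev in `L²` on the second set);
* STUB 4 `stub_weakL3_early` — THIS FILE: bounded weak-`L³` slices on every `[0,t₀]`, `t₀ < T` (Tao's
  class on the closed sub-slab, tree `RungReynoldsOne.stub_taoCover`; a bounded `L²` slice is weak-`L³`:
  levels `≥ B` are empty, levels `< B` pay `λ·λ²|{λ<|u|}| ≤ B·2E(u₀)` by Chebyshev — the argument of
  `LorentzOfEnvelope.eWeakLpPow_three_le_of_norm_le`, inlined to keep this module route-independent);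
* STUB 5 `stub_trace_of_slices` — THIS FILE (converse, Fatou): bounded weak-`L³` late slices pass to the
  terminal slice along the STRONG `L²` convergence `u(s) → u(T)` supplied by the edge bound (tree
  `FunctionSpaces.eWeakLpPow_le_of_tendsto_eLpNorm`).

All statements are the registered signatures with the line's Cruxes-local predicates `SliceLaw`,
`EdgeBound`, `FastWeakL3Bound` UNFOLDED VERBATIM. The one-slice transfer is isolated as
`eWeakLpPow_three_le_of_edge_of_fast` with a free threshold `Λ` (used again on the Type-I stratum in
the companion assembly file). HONEST FRAMING: bookkeeping along a HYPOTHETICAL blow-up; no registered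
stub of the skeleton of record `Lines/sparse_sieve.lean` is touched; `EnstrophyQuarterLaw` (1574),
`LorentzUpgradeTypeI` (24108) and NS regularity stay OPEN; nothing here proves a summit.
References: Grafakos, *Classical Fourier Analysis* Prop. 1.1.3 (Fatou in `L^{p,∞}`); Leray 1934 §31.
-/

noncomputable section

-- the summit-side namespace repeats a component by design (D-0017)
set_option linter.dupNamespace false

namespace Summit.NavierStokesRegularity.NavierStokesRegularity.Theorems.EnstrophyQuarterLaw.WeakTrace

open Set MeasureTheory Function Metric Filter Topology
open scoped ENNReal NNReal
open Literature.Analysis.FluidPDE Literature.Analysis.FunctionSpaces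

variable {ν T : ℝ} {u : ℝ → EuclideanSpace ℝ (Fin 3) → EuclideanSpace ℝ (Fin 3)}
  {p : ℝ → EuclideanSpace ℝ (Fin 3) → ℝ}

/-! ### Level bookkeeping -/

/-- The `ℝ≥0`-level expression of `eWeakLpPow · 3` in real form:
`μ³ · |{μ < ‖v‖ₑ}| = ofReal (μ³) · |{μ < ‖v‖}|`. [folklore] -/
theorem coe_rpow_three_mul_volume_eq {X : Type*} [MeasurableSpace X] (vol : Measure X)
    {F : Type*} [NormedAddCommGroup F] (v : X → F) (μ : ℝ≥0) :
    (μ : ℝ≥0∞) ^ (3 : ℝ) * vol {x | (μ : ℝ≥0∞) < ‖v x‖ₑ} =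
      ENNReal.ofReal ((μ : ℝ) ^ 3) * vol {x | (μ : ℝ) < ‖v x‖} := by
  have e1 : (μ : ℝ≥0∞) ^ (3 : ℝ) = ENNReal.ofReal ((μ : ℝ) ^ 3) := by
    rw [show (3 : ℝ) = ((3 : ℕ) : ℝ) by norm_num, ENNReal.rpow_natCast, ← ENNReal.ofReal_coe_nnreal,
      ENNReal.ofReal_pow μ.coe_nonneg]
  have e2 : {x | (μ : ℝ≥0∞) < ‖v x‖ₑ} = {x | (μ : ℝ) < ‖v x‖} := by
    ext x
    simp only [mem_setOf_eq]
    rw [← ofReal_norm, ← ENNReal.ofReal_coe_nnreal,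
      ENNReal.ofReal_lt_ofReal_iff_of_nonneg μ.coe_nonneg]
  rw [e1, e2]

/-- Each REAL level `σ ≥ 0` is paid by the weak-`L³` quasi-norm:
`ofReal (σ³) · |{σ < ‖z‖}| ≤ eWeakLpPow z 3`. [folklore] -/
theorem ofReal_cube_mul_volume_le_eWeakLpPow {X : Type*} [MeasurableSpace X] (vol : Measure X)
    {F : Type*} [NormedAddCommGroup F] (z : X → F) {σ : ℝ} (hσ : 0 ≤ σ) :
    ENNReal.ofReal (σ ^ 3) * vol {x | σ < ‖z x‖} ≤ eWeakLpPow z 3 vol := by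
  have h := rpow_mul_meas_lt_le_eWeakLpPow z 3 vol (Real.toNNReal σ)
  rw [ENNReal.toReal_ofNat, coe_rpow_three_mul_volume_eq, Real.coe_toNNReal _ hσ] at h
  exact h

/-- **Cubic Chebyshev above a threshold.** For continuous `v` and levels `0 ≤ λ ≤ τ`:
`ofReal (τ³) · |{τ < ‖v‖}| ≤ ∫_{λ < ‖v‖} ‖v‖ₑ³`. [folklore] -/
theorem ofReal_cube_mul_volume_le_setLIntegral_cube
    {v : EuclideanSpace ℝ (Fin 3) → EuclideanSpace ℝ (Fin 3)} (hv : Continuous v)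
    {lam τ : ℝ} (hlam : lam ≤ τ) (hτ : 0 ≤ τ) :
    ENNReal.ofReal (τ ^ 3) * volume {x | τ < ‖v x‖} ≤
      ∫⁻ x in {x | lam < ‖v x‖}, ‖v x‖ₑ ^ 3 := by
  have hA : MeasurableSet {x : EuclideanSpace ℝ (Fin 3) | lam < ‖v x‖} :=
    (isOpen_lt continuous_const hv.norm).measurableSet
  set g : EuclideanSpace ℝ (Fin 3) → ℝ≥0∞ := {x | lam < ‖v x‖}.indicator fun x => ‖v x‖ₑ ^ 3
    with hg
  have hgm : AEMeasurable g volume :=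
    ((hv.measurable.enorm.pow_const 3).indicator hA).aemeasurable
  have hsub : {x | τ < ‖v x‖} ⊆ {x | ENNReal.ofReal (τ ^ 3) ≤ g x} := by
    intro x hx
    simp only [mem_setOf_eq] at hx ⊢
    have hxA : x ∈ {x | lam < ‖v x‖} := lt_of_le_of_lt hlam hx
    rw [hg, indicator_of_mem hxA, ← ofReal_norm, ← ENNReal.ofReal_pow (norm_nonneg _)]
    exact ENNReal.ofReal_le_ofReal (pow_le_pow_left₀ hτ hx.le 3)
  calc ENNReal.ofReal (τ ^ 3) * volume {x | τ < ‖v x‖}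
      ≤ ENNReal.ofReal (τ ^ 3) * volume {x | ENNReal.ofReal (τ ^ 3) ≤ g x} :=
        mul_le_mul' le_rfl (measure_mono hsub)
    _ ≤ ∫⁻ x, g x := mul_meas_ge_le_lintegral₀ hgm _
    _ = ∫⁻ x in {x | lam < ‖v x‖}, ‖v x‖ₑ ^ 3 := lintegral_indicator hA _

/-! ### STUB 2 — the fast levels are paid by the slice law -/

/-- **STUB 2 of line «weak_trace», registered signature with `SliceLaw` / `FastWeakL3Bound` unfolded
verbatim.** For `ν, T > 0`, `(u, p)` classical on `[0,T) × ℝ³`, Leray–Hopf on `[0,T]` from the (rapidly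
decaying) datum `u 0`, the slice law `∫|curl u(t)|² ≤ K/√(T−t)` on `[0,T)` pays every level above the
self-similar threshold: `μ³ |{μ < |u(s)|}| ≤ C` for all `s ∈ [0,T)` and `μ ≥ (√(T−s))⁻¹`, with
`C = C_S⁶ (max K 0)³` (cubic Chebyshev on `TraceTransfer.stub_fastL3`). [folklore] -/
theorem stub_fastWeakL3 :
    ∀ (ν T : ℝ), 0 < ν → 0 < T →
      ∀ (u : ℝ → EuclideanSpace ℝ (Fin 3) → EuclideanSpace ℝ (Fin 3)) (p : ℝ → EuclideanSpace ℝ (Fin 3) → ℝ),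
        IsClassicalNSSolutionOn (Set.Ico 0 T) ν 0 u p → IsLerayHopfOn T ν 0 (u 0) u →
        HasRapidSpatialDecay (u 0) → ∀ K : ℝ,
        (∀ t ∈ Set.Ico 0 T, ∫⁻ x, ‖curl (u t) x‖ₑ ^ 2 ≤ ENNReal.ofReal (K / Real.sqrt (T - t))) →
        ∃ C : ℝ, ∀ s ∈ Set.Ico 0 T, ∀ μ : ℝ≥0, (Real.sqrt (T - s))⁻¹ ≤ (μ : ℝ) →
          (μ : ℝ≥0∞) ^ (3 : ℝ) * volume {x | (μ : ℝ≥0∞) < ‖u s x‖ₑ} ≤ ENNReal.ofReal C := by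
  intro ν T hν hT u p hsol hLH hdec K hK
  obtain ⟨C, hC⟩ := TraceTransfer.stub_fastL3 ν T hν hT u p hsol hLH hdec K hK
  refine ⟨C, fun s hs μ hμ => ?_⟩
  have hcont : Continuous (u s) := (hsol.contDiff_velocity hs).continuous
  rw [coe_rpow_three_mul_volume_eq]
  exact (ofReal_cube_mul_volume_le_setLIntegral_cube hcont hμ μ.coe_nonneg).trans (hC s hs)

/-! ### The one-slice weak trace transfer -/

/-- The superlevel set of `v` at level `σ` lies in the union of the superlevel sets of `z` and of
`v − z` at level `σ/2`. [folklore] -/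
theorem setOf_lt_norm_subset_union {X : Type*} {F : Type*} [NormedAddCommGroup F] (v z : X → F)
    (σ : ℝ) :
    {x | σ < ‖v x‖} ⊆ {x | σ / 2 < ‖z x‖} ∪ {x | σ / 2 < ‖v x - z x‖} := by
  intro x hx
  simp only [mem_setOf_eq, mem_union] at hx ⊢
  by_cases h1 : σ / 2 < ‖z x‖
  · exact Or.inl h1
  · right
    have h1' : ‖z x‖ ≤ σ / 2 := not_lt.1 h1
    have : ‖v x‖ ≤ ‖z x‖ + ‖v x - z x‖ := by
      calc ‖v x‖ = ‖z x + (v x - z x)‖ := by rw [add_sub_cancel]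
        _ ≤ ‖z x‖ + ‖v x - z x‖ := norm_add_le _ _
    linarith

/-- **One-slice WEAK TRACE TRANSFER** (pure measure theory). Let `v, z` be a.e.-strongly measurable,
`∫ ‖v − z‖ₑ² ≤ B`, let every level `σ ≥ Λ > 0` of `v` be paid (`σ³|{σ<‖v‖}| ≤ C_f`) and let
`‖z‖³_{3,∞} ≤ n`. Then `‖v‖³_{3,∞} ≤ C_f + 8n + 4ΛB`: below `Λ`,
`σ³|{σ<‖v‖}| ≤ 8 (σ/2)³|{σ/2<‖z‖}| + 4σ (σ/2)²|{σ/2<‖v−z‖}| ≤ 8n + 4σB ≤ 8n + 4ΛB`. [folklore] -/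
theorem eWeakLpPow_three_le_of_edge_of_fast
    {v z : EuclideanSpace ℝ (Fin 3) → EuclideanSpace ℝ (Fin 3)}
    (hv : AEStronglyMeasurable v volume) (hz : AEStronglyMeasurable z volume)
    {B Cf n Λ : ℝ} (hΛ : 0 < Λ) (hB : 0 ≤ B) (hCf : 0 ≤ Cf) (hn : 0 ≤ n)
    (hedge : ∫⁻ x, ‖v x - z x‖ₑ ^ 2 ≤ ENNReal.ofReal B)
    (hfast : ∀ σ : ℝ, Λ ≤ σ → ENNReal.ofReal (σ ^ 3) * volume {x | σ < ‖v x‖} ≤ ENNReal.ofReal Cf)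
    (hz3 : eWeakLpPow z 3 volume ≤ ENNReal.ofReal n) :
    eWeakLpPow v 3 volume ≤ ENNReal.ofReal (Cf + 8 * n + 4 * Λ * B) := by
  have h3 : (0 : ℝ) < (3 : ℝ≥0∞).toReal := by norm_num
  refine Wu2026Salvage.eWeakLpPow_le_of_forall h3 fun σ hσ => ?_
  have e3 : ENNReal.ofReal (σ ^ (3 : ℝ≥0∞).toReal) = ENNReal.ofReal (σ ^ 3) := by norm_num
  rw [e3]
  rcases le_or_gt Λ σ with hhigh | hlow
  · exact (hfast σ hhigh).trans (ENNReal.ofReal_le_ofReal (by nlinarith))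
  · -- below the threshold: split the superlevel set
    have hσ2 : 0 < σ / 2 := half_pos hσ
    have hsub := setOf_lt_norm_subset_union v z σ
    -- the `z`-part is paid by the weak-L³ quasi-norm of `z`
    have hzpart : ENNReal.ofReal (σ ^ 3) * volume {x | σ / 2 < ‖z x‖} ≤ 8 * ENNReal.ofReal n := by
      have h1 := (ofReal_cube_mul_volume_le_eWeakLpPow volume z hσ2.le).trans hz3
      have e8 : ENNReal.ofReal (σ ^ 3) = 8 * ENNReal.ofReal ((σ / 2) ^ 3) := by
        rw [show (8 : ℝ≥0∞) = ENNReal.ofReal 8 by norm_num, ← ENNReal.ofReal_mul (by norm_num)]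
        congr 1; ring
      rw [e8, mul_assoc]
      exact mul_le_mul' le_rfl h1
    -- the `v − z`-part is paid by Chebyshev in `L²` and the edge bound
    have hwpart : ENNReal.ofReal (σ ^ 3) * volume {x | σ / 2 < ‖v x - z x‖} ≤
        ENNReal.ofReal (4 * Λ * B) := by
      have hcheb := LorentzOfEnvelope.sq_mul_meas_superlevel_le_lintegral (hv.sub hz) hσ2
      have e4 : ENNReal.ofReal (σ ^ 3) = ENNReal.ofReal (4 * σ) * ENNReal.ofReal ((σ / 2) ^ 2) := by
        rw [← ENNReal.ofReal_mul (by nlinarith)]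
        congr 1; ring
      rw [e4, mul_assoc]
      calc ENNReal.ofReal (4 * σ) * (ENNReal.ofReal ((σ / 2) ^ 2) * volume {x | σ / 2 < ‖v x - z x‖})
          ≤ ENNReal.ofReal (4 * σ) * ENNReal.ofReal B := mul_le_mul' le_rfl (hcheb.trans hedge)
        _ = ENNReal.ofReal (4 * σ * B) := (ENNReal.ofReal_mul (by nlinarith)).symm
        _ ≤ ENNReal.ofReal (4 * Λ * B) := ENNReal.ofReal_le_ofReal (by nlinarith)
    calc ENNReal.ofReal (σ ^ 3) * volume {x | σ < ‖v x‖}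
        ≤ ENNReal.ofReal (σ ^ 3) * volume ({x | σ / 2 < ‖z x‖} ∪ {x | σ / 2 < ‖v x - z x‖}) :=
          mul_le_mul' le_rfl (measure_mono hsub)
      _ ≤ ENNReal.ofReal (σ ^ 3) *
            (volume {x | σ / 2 < ‖z x‖} + volume {x | σ / 2 < ‖v x - z x‖}) :=
          mul_le_mul' le_rfl (measure_union_le _ _)
      _ = ENNReal.ofReal (σ ^ 3) * volume {x | σ / 2 < ‖z x‖} +
            ENNReal.ofReal (σ ^ 3) * volume {x | σ / 2 < ‖v x - z x‖} := mul_add _ _ _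
      _ ≤ 8 * ENNReal.ofReal n + ENNReal.ofReal (4 * Λ * B) := add_le_add hzpart hwpart
      _ = ENNReal.ofReal (8 * n + 4 * Λ * B) := by
          rw [show (8 : ℝ≥0∞) = ENNReal.ofReal 8 by norm_num, ← ENNReal.ofReal_mul (by norm_num),
            ← ENNReal.ofReal_add (by nlinarith) (by nlinarith)]
      _ ≤ ENNReal.ofReal (Cf + 8 * n + 4 * Λ * B) := ENNReal.ofReal_le_ofReal (by nlinarith)

/-! ### STUB 3 — weak trace transfer under the edge bound -/

/-- **STUB 3 of line «weak_trace», registered signature with `EdgeBound` / `FastWeakL3Bound` unfolded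
verbatim** (the lever): for `(u, p)` classical on `[0,T)`, Leray–Hopf on `[0,T]`, the edge bound
`∫|u(s) − u(T)|² ≤ D√(T−s)` on `[t₀,T)` (`0 ≤ t₀ < T`), the fast-level bound `μ³|{μ<|u(s)|}| ≤ C`
(`μ ≥ (√(T−s))⁻¹`) and `u(T) ∈ L^{3,∞}` bound the weak-`L³` quasi-norms of all late slices:
`‖u(s)‖³_{3,∞} ≤ max C 0 + 8‖u(T)‖³_{3,∞} + 4 max D 0` on `[t₀,T)`. [folklore] -/
theorem stub_weakTransfer :
    ∀ (ν T : ℝ), 0 < ν → 0 < T →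
      ∀ (u : ℝ → EuclideanSpace ℝ (Fin 3) → EuclideanSpace ℝ (Fin 3)) (p : ℝ → EuclideanSpace ℝ (Fin 3) → ℝ),
        IsClassicalNSSolutionOn (Set.Ico 0 T) ν 0 u p → IsLerayHopfOn T ν 0 (u 0) u →
        ∀ (D t₀ C : ℝ), 0 ≤ t₀ → t₀ < T →
        (∀ s ∈ Set.Ico t₀ T, ∫⁻ x, ‖u s x - u T x‖ₑ ^ 2 ≤ ENNReal.ofReal (D * Real.sqrt (T - s))) →
        (∀ s ∈ Set.Ico 0 T, ∀ μ : ℝ≥0, (Real.sqrt (T - s))⁻¹ ≤ (μ : ℝ) →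
          (μ : ℝ≥0∞) ^ (3 : ℝ) * volume {x | (μ : ℝ≥0∞) < ‖u s x‖ₑ} ≤ ENNReal.ofReal C) →
        eWeakLpPow (u T) 3 volume < ⊤ →
        ∃ M' : ℝ, ∀ s ∈ Set.Ico t₀ T, eWeakLpPow (u s) 3 volume ≤ ENNReal.ofReal M' := by
  intro ν T hν hT u p hsol hLH D t₀ C ht₀ ht₀T hedge hfast hTop
  set n : ℝ := (eWeakLpPow (u T) 3 volume).toReal with hn
  have hn0 : 0 ≤ n := ENNReal.toReal_nonneg
  have hz3 : eWeakLpPow (u T) 3 volume ≤ ENNReal.ofReal n := by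
    rw [hn, ENNReal.ofReal_toReal hTop.ne]
  have hz : AEStronglyMeasurable (u T) volume := (hLH.memLp T ⟨hT.le, le_rfl⟩).1
  refine ⟨max C 0 + 8 * n + 4 * max D 0, fun s hs => ?_⟩
  have hs0 : s ∈ Ico 0 T := ⟨ht₀.trans hs.1, hs.2⟩
  have hτ : 0 < T - s := sub_pos.2 hs.2
  have hsq : 0 < Real.sqrt (T - s) := Real.sqrt_pos.2 hτ
  have hΛ : 0 < (Real.sqrt (T - s))⁻¹ := inv_pos.2 hsq
  have hv : AEStronglyMeasurable (u s) volume := (hsol.contDiff_velocity hs0).continuous.aestronglyMeasurable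
  -- the edge bound with `max D 0`
  have hedge' : ∫⁻ x, ‖u s x - u T x‖ₑ ^ 2 ≤ ENNReal.ofReal (max D 0 * Real.sqrt (T - s)) :=
    (hedge s hs).trans (ENNReal.ofReal_le_ofReal
      (mul_le_mul_of_nonneg_right (le_max_left _ _) hsq.le))
  -- the fast levels in real form, with `max C 0`
  have hfast' : ∀ σ : ℝ, (Real.sqrt (T - s))⁻¹ ≤ σ →
      ENNReal.ofReal (σ ^ 3) * volume {x | σ < ‖u s x‖} ≤ ENNReal.ofReal (max C 0) := by
    intro σ hσ
    have hσ0 : 0 ≤ σ := hΛ.le.trans hσ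
    have h := hfast s hs0 (Real.toNNReal σ) (by rwa [Real.coe_toNNReal _ hσ0])
    rw [coe_rpow_three_mul_volume_eq, Real.coe_toNNReal _ hσ0] at h
    exact h.trans (ENNReal.ofReal_le_ofReal (le_max_left _ _))
  have key := eWeakLpPow_three_le_of_edge_of_fast hv hz hΛ (by positivity) (le_max_right _ _) hn0
    hedge' hfast' hz3
  have hne : Real.sqrt (T - s) ≠ 0 := hsq.ne'
  have e : 4 * (Real.sqrt (T - s))⁻¹ * (max D 0 * Real.sqrt (T - s)) = 4 * max D 0 := by
    field_simp
  refine key.trans (ENNReal.ofReal_le_ofReal (le_of_eq ?_))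
  rw [e]

/-! ### STUB 4 — the early times are free -/

/-- **STUB 4 of line «weak_trace», registered signature verbatim**: a classical solution on `[0,T)`
(`ν, T > 0`), Leray–Hopf from its rapidly decaying datum, has bounded weak-`L³` slices on every
`[0,t₀]`, `t₀ < T`: on the closed sub-slab `[0, (max t₀ 0 + T)/2]` it lies in Tao's class, hence is
bounded by some `B`, and a bounded `L²` slice has `‖u(s)‖³_{3,∞} ≤ B · 2E(u₀)`.
[cite: Tao2011, Thm. 5.4 (i)+(iv)] -/
theorem stub_weakL3_early :
    ∀ (ν T : ℝ), 0 < ν → 0 < T →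
      ∀ (u : ℝ → EuclideanSpace ℝ (Fin 3) → EuclideanSpace ℝ (Fin 3)) (p : ℝ → EuclideanSpace ℝ (Fin 3) → ℝ),
        IsClassicalNSSolutionOn (Set.Ico 0 T) ν 0 u p → IsLerayHopfOn T ν 0 (u 0) u →
        HasRapidSpatialDecay (u 0) → ∀ t₀ : ℝ, t₀ < T →
        ∃ M' : ℝ, ∀ s ∈ Set.Icc 0 t₀, eWeakLpPow (u s) 3 volume ≤ ENNReal.ofReal M' := by
  intro ν T hν hT u p hsol hLH hdec t₀ ht₀T
  -- a closed sub-slab `[0, t₁]` with `t₀ ≤ t₁`, `0 < t₁ < T`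
  set t₁ : ℝ := (max t₀ 0 + T) / 2 with ht₁
  have hmax : max t₀ 0 < T := max_lt ht₀T hT
  have ht₁pos : 0 < t₁ := by rw [ht₁]; linarith [le_max_right t₀ 0]
  have ht₁T : t₁ < T := by rw [ht₁]; linarith
  have ht₀t₁ : t₀ ≤ t₁ := by rw [ht₁]; linarith [le_max_left t₀ 0]
  obtain ⟨q, hsolq, hBq, -, -⟩ := RungReynoldsOne.stub_taoCover hν hT hsol hLH hdec ⟨ht₁pos, ht₁T⟩
  obtain ⟨B, hB0, hB⟩ := exists_forall_norm_le_of_hasBoundedSobolevNormsOn hsolq hBq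
  set E : ℝ := 2 * VectorCalculus.kineticEnergy (u 0) with hE_def
  refine ⟨B * E, fun s hs => ?_⟩
  have hsI : s ∈ Icc 0 t₁ := ⟨hs.1, hs.2.trans ht₀t₁⟩
  have hsT : s ∈ Icc 0 T := ⟨hs.1, (hs.2.trans ht₀t₁).trans ht₁T.le⟩
  have hv : AEStronglyMeasurable (u s) volume := (hLH.memLp s hsT).1
  have hE : ∫⁻ x, ‖u s x‖ₑ ^ 2 ≤ ENNReal.ofReal E := hLH.lintegral_enorm_sq_le hν.le hsT
  -- bounded (`‖u s‖ ≤ B`) + `L²` ⟹ weak-`L³`: levels `≥ B` are empty, levels `< B` by Chebyshev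
  have h3 : (0 : ℝ) < (3 : ℝ≥0∞).toReal := by norm_num
  refine Wu2026Salvage.eWeakLpPow_le_of_forall h3 fun lam hlam => ?_
  have e3 : ENNReal.ofReal (lam ^ (3 : ℝ≥0∞).toReal) = ENNReal.ofReal (lam ^ 3) := by norm_num
  rw [e3]
  rcases le_or_gt B lam with hhigh | hlow
  · have hempty : {x | lam < ‖u s x‖} = ∅ :=
      eq_empty_of_forall_notMem fun x hx =>
        absurd (lt_of_lt_of_le hx (hB s hsI x)) (not_lt.2 hhigh)
    rw [hempty, measure_empty, mul_zero]
    exact zero_le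
  · have hcheb := LorentzOfEnvelope.sq_mul_meas_superlevel_le_lintegral hv hlam
    have hsplit : ENNReal.ofReal (lam ^ 3) = ENNReal.ofReal lam * ENNReal.ofReal (lam ^ 2) := by
      rw [← ENNReal.ofReal_mul hlam.le]; ring_nf
    calc ENNReal.ofReal (lam ^ 3) * volume {x | lam < ‖u s x‖}
        = ENNReal.ofReal lam * (ENNReal.ofReal (lam ^ 2) * volume {x | lam < ‖u s x‖}) := by
          rw [hsplit, mul_assoc]
      _ ≤ ENNReal.ofReal B * ENNReal.ofReal E :=
          mul_le_mul' (ENNReal.ofReal_le_ofReal hlow.le) (hcheb.trans hE)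
      _ = ENNReal.ofReal (B * E) := (ENNReal.ofReal_mul hB0).symm

/-! ### STUB 5 — Fatou: bounded weak-`L³` slices pass to the terminal slice -/

/-- **STUB 5 of line «weak_trace», registered signature with `EdgeBound` unfolded verbatim**
(converse of the transfer): if the late slices `u(s)`, `s ∈ [t₀,T)`, have `‖u(s)‖³_{3,∞} ≤ M'` and
the edge bound `∫|u(s) − u(T)|² ≤ D√(T−s)` holds on `[t₀,T)`, then `u(T) ∈ L^{3,∞}`: along
`sₙ = T − δ/(n+2)` (`δ = T − max t₀ 0`) the slices converge to `u(T)` in `L²`, and uniform weak-`L³`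
bounds pass to `L²` limits (Fatou on the level sets, along an a.e. subsequence).
[cite: Grafakos2014, Prop. 1.1.3] -/
theorem stub_trace_of_slices :
    ∀ (ν T : ℝ), 0 < ν → 0 < T →
      ∀ (u : ℝ → EuclideanSpace ℝ (Fin 3) → EuclideanSpace ℝ (Fin 3)) (p : ℝ → EuclideanSpace ℝ (Fin 3) → ℝ),
        IsClassicalNSSolutionOn (Set.Ico 0 T) ν 0 u p → IsLerayHopfOn T ν 0 (u 0) u →
        ∀ (D t₀ : ℝ), t₀ < T →
        (∀ s ∈ Set.Ico t₀ T, ∫⁻ x, ‖u s x - u T x‖ₑ ^ 2 ≤ ENNReal.ofReal (D * Real.sqrt (T - s))) →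
        (∃ M' : ℝ, ∀ s ∈ Set.Ico t₀ T, eWeakLpPow (u s) 3 volume ≤ ENNReal.ofReal M') →
        eWeakLpPow (u T) 3 volume < ⊤ := by
  intro ν T hν hT u p hsol hLH D t₀ ht₀T hedge hbound
  obtain ⟨M', hM'⟩ := hbound
  -- the approximating times
  set δ : ℝ := T - max t₀ 0 with hδ
  have hδpos : 0 < δ := by rw [hδ]; exact sub_pos.2 (max_lt ht₀T hT)
  set sq : ℕ → ℝ := fun k => T - δ / ((k : ℝ) + 2) with hsq
  have hk2 : ∀ k : ℕ, (0 : ℝ) < (k : ℝ) + 2 := fun k => by positivity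
  have hsq_lt : ∀ k, sq k < T := fun k => by
    simp only [hsq]; linarith [div_pos hδpos (hk2 k)]
  have hsq_ge : ∀ k, max t₀ 0 ≤ sq k := fun k => by
    simp only [hsq]
    have : δ / ((k : ℝ) + 2) ≤ δ := by
      rw [div_le_iff₀ (hk2 k)]; nlinarith [hδpos.le, (Nat.cast_nonneg k : (0 : ℝ) ≤ k)]
    linarith
  have hsq_t₀ : ∀ k, sq k ∈ Ico t₀ T := fun k => ⟨(le_max_left _ _).trans (hsq_ge k), hsq_lt k⟩
  have hsq_0 : ∀ k, sq k ∈ Ico 0 T := fun k => ⟨(le_max_right _ _).trans (hsq_ge k), hsq_lt k⟩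
  -- measurability
  have hf : ∀ k, AEStronglyMeasurable (u (sq k)) volume := fun k =>
    (hsol.contDiff_velocity (hsq_0 k)).continuous.aestronglyMeasurable
  have hg : AEStronglyMeasurable (u T) volume := (hLH.memLp T ⟨hT.le, le_rfl⟩).1
  -- `L²` convergence from the edge bound
  have hD0 : ∀ k, ∫⁻ x, ‖u (sq k) x - u T x‖ₑ ^ 2 ≤
      ENNReal.ofReal (max D 0 * Real.sqrt (δ / ((k : ℝ) + 2))) := fun k => by
    have h := hedge (sq k) (hsq_t₀ k)
    have e : T - sq k = δ / ((k : ℝ) + 2) := by simp only [hsq]; ring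
    rw [e] at h
    exact h.trans (ENNReal.ofReal_le_ofReal
      (mul_le_mul_of_nonneg_right (le_max_left _ _) (Real.sqrt_nonneg _)))
  have hlim : Tendsto (fun k => eLpNorm (u (sq k) - u T) 2 volume) atTop (𝓝 0) := by
    -- the real upper bound tends to `0`
    have h1 : Tendsto (fun k : ℕ => δ / ((k : ℝ) + 2)) atTop (𝓝 0) := by
      have h := (tendsto_const_div_atTop_nhds_zero_nat δ).comp (tendsto_add_atTop_nat 2)
      refine h.congr fun k => ?_
      simp only [Function.comp_apply, Nat.cast_add, Nat.cast_ofNat]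
    have h2 : Tendsto (fun k : ℕ => max D 0 * Real.sqrt (δ / ((k : ℝ) + 2))) atTop (𝓝 0) := by
      have h := ((Real.continuous_sqrt.tendsto 0).comp h1).const_mul (max D 0)
      rw [Real.sqrt_zero, mul_zero] at h
      exact h
    have h3 : Tendsto (fun k : ℕ => ENNReal.ofReal (max D 0 * Real.sqrt (δ / ((k : ℝ) + 2))))
        atTop (𝓝 0) := by
      rw [← ENNReal.ofReal_zero]
      exact ENNReal.tendsto_ofReal h2
    have h4 : Tendsto (fun k : ℕ =>
        ENNReal.ofReal (max D 0 * Real.sqrt (δ / ((k : ℝ) + 2))) ^ (1 / 2 : ℝ))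
        atTop (𝓝 ((0 : ℝ≥0∞) ^ (1 / 2 : ℝ))) :=
      (ENNReal.continuous_rpow_const.tendsto 0).comp h3
    rw [ENNReal.zero_rpow_of_pos (by norm_num : (0 : ℝ) < 1 / 2)] at h4
    -- the `L²` norms are below that bound
    have hbound : ∀ k, eLpNorm (u (sq k) - u T) 2 volume ≤
        ENNReal.ofReal (max D 0 * Real.sqrt (δ / ((k : ℝ) + 2))) ^ (1 / 2 : ℝ) := by
      intro k
      have h2k := eLpNorm_natCast_pow_eq_lintegral volume (u (sq k) - u T) (n := 2) two_ne_zero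
      simp only [Nat.cast_ofNat, Pi.sub_apply] at h2k
      have hsqle : eLpNorm (u (sq k) - u T) 2 volume ^ (2 : ℕ) ≤
          ENNReal.ofReal (max D 0 * Real.sqrt (δ / ((k : ℝ) + 2))) := by
        rw [h2k]; exact hD0 k
      calc eLpNorm (u (sq k) - u T) 2 volume
          = (eLpNorm (u (sq k) - u T) 2 volume ^ (2 : ℕ)) ^ (1 / 2 : ℝ) := by
            rw [← ENNReal.rpow_natCast, ← ENNReal.rpow_mul]; norm_num
        _ ≤ ENNReal.ofReal (max D 0 * Real.sqrt (δ / ((k : ℝ) + 2))) ^ (1 / 2 : ℝ) :=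
            ENNReal.rpow_le_rpow hsqle (by norm_num)
    exact tendsto_of_tendsto_of_tendsto_of_le_of_le tendsto_const_nhds h4 (fun _ => zero_le)
      hbound
  have hle := eWeakLpPow_le_of_tendsto_eLpNorm (p := 3) hf hg two_ne_zero hlim
    (C := ENNReal.ofReal M') fun k => hM' (sq k) (hsq_t₀ k)
  exact hle.trans_lt ENNReal.ofReal_lt_top

end Summit.NavierStokesRegularity.NavierStokesRegularity.Theorems.EnstrophyQuarterLaw.WeakTrace

end
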